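import Summits.QuantumFields.BalabanUV.T4Continuum.Support.SmoothRefineOfApprox
import Summits.QuantumFields.BalabanUV.T4Continuum.Support.SkeletonPrecomp
import HarnessLib

/-!
# T⁴ programme, node NE3 (η-rate of the minimisers) — THE ACTION SANDWICH, final assembly, part 1:
# ONE SMALLNESS REGIME DISCHARGES EVERY NUMERIC SIDE CONDITION OF THE COMPOSITION OF ROUTE (A)

NE3 prover lineage P1, gen 18 (cell `pub-balaban`, unit `b2b-balaban-t4-ne3-p1`, `HOME/BINDER-OWNERS.md` row NE3 OWNER;
skeleton `t4/b2b-balaban-t4-ne3-p1/SKELETON-NE3-P1.md` v1.4; g17 HANDOFF «NEXT GEN (1): … check the side conditions close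
for small b»).

THE SITUATION.  Route (A) of NE3 (the η-rate of Bałaban's minimal ACTIONS) is a composition of landed modules: the
owner END `MinimalActionRateExists.actionRate_sfClass_of_exists_approxRefine` (p212324) concludes
`T4EtaRateMin.ActionRate (minActReadings d (sfClass d L N ε) L N dom loc) (…) (L⁻²)` from (H∃) «one REGULAR minimiser per
level» ([Balaban1985Variational] Thm 1 p. 279 TYPE) and `ApproxRefine d (sfClass …) L N b c b₁ c₁ m` under SIX numeric side
conditions `hBs hbε hbs₁ hgap hhalf hε` (`g = gap d L = L^{1−d}`); the crew's `ApproxRefineAssembly.approxRefine_of_fillBounds`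
(leaf-09, p212443) proves `ApproxRefine … m⋆`, `m⋆ = 3·(1280·d(d+1)²(d+4)²L²b₁² + d(d+1)c₁ + (d−1)²(c + (37(d−1)+4)b²))`,
under FOUR more (`h16 hhalf hquarter h512`).  Are the ten jointly satisfiable, uniformly in the level, for small radii —
and how small?  This file answers with ONE regime (pure real arithmetic; no new mathematics):

§1 `approxRefine_mono` — `ApproxRefine` is monotone in the mismatch constant (any `m ≥ m⋆` may be carried).
§2 THE REGIME.  With the REFINED RADIUS `r := b₁ + 8mL³/g` the three inequalities
     (Rb) `2¹⁵(d+1)²(d+4)²L²·b ≤ 1`,    (Rr) `2¹⁰(d+1)(d+4)L²·r ≤ g`,    (Rε) `2·max b r ≤ ε`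
   give the six (`sideConds_of_regime`) and, with the single link `3(d−1)²c ≤ m` to the mismatch constant, the four
   (`fillConds_of_regime`).  In B11's letters: `b` = the regularity radius `B₃ε₁` of the space (8), `r` = the radius of
   the kinematic refinement (of the order of the flux-gradient constant `B₃Mε₁` of (9)), `ε` = the CLASS radius `ε₀` of
   (6); (Rε) is Thm 1's own ordering «B₃ε₁ ≤ ε₀», (Rb)∕(Rr) are «ε₁ small depending on d and L only».
§3 ONE THRESHOLD (`regime_of_small`): `b, b₁, c, c₁ ≤ t` with `2¹⁷(d+1)³(d+4)²L^{2d+3}·t ≤ 1` (`d ≥ 1`) gives `m⋆ ≤ 9(d+1)²t`,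
   (Rb), (Rr) with `m := 9(d+1)²t`, and `2·max b r ≤ 146(d+1)²L^{d+2}·t`.  At `d = 4`, `L = 2`: `t ≤ 4.6·10⁻¹³`,
   `ε ≥ 2.4·10⁵·t` — crude and explicit (leaf-09's `1280·d(d+1)²(d+4)²`, the gap `L^{1−d}`, B7 Prop. 1's `512(d+1)(d+4)`).
Part 2 (`MinimalActionFinal`) feeds these into the ENDs.

HONEST FRAMING.  Arithmetic bookkeeping; **NE3 is NOT proved** ((H∃) and the two filling bounds of leaf R1 remain
hypotheses of part 2; the LOCAL half of `T4EtaRateMin.NE3Shape` is untouched; spine PROVED count 0∕9).  No conditional of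
the cell (`BetaPertH`, (B), (B^μ), G-an2-4) occurs; nothing printed is a hypothesis; no `def`, no `sorry`, axioms ⊆
{propext, Classical.choice, Quot.sound}.  Finite T⁴ rung (B)+1 — NOT infinite volume, NOT a mass gap, NOT the Clay
problem, NOT summit progress.  Context: T. Bałaban, Commun. Math. Phys. **102** (1985) 277–309 [Balaban1985Variational]
(5)–(10) pp. 278–279.  PLACEMENT (human rule 2026-08-19): `Summits/QuantumFields/BalabanUV/`.  HONEST DEPENDENCY (cell
page 1): continuum YM on T⁴ ⇐ BetaPertH ∧ nine spine estimates (0/9 proved); BetaPertH ⇐ (D1) ∧ (D4) ∧ CAP+tail; G-an2-4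
gates asym, D1 and NE2/3/4.
-/

set_option autoImplicit false

open scoped BigOperators Matrix Matrix.Norms.L2Operator
open NormedSpace

namespace Summit.QuantumFields.BalabanUV.T4Continuum.MinimalActionRegime

open Literature.MathematicalPhysics.QuantumFieldTheory.Balaban1983to89
open B7Prop1Explicit B7Prop2Explicit
open T4AveragingDeficitWall hiding Site Plane Plaq Bond
open MinimalActionRefine SmoothRefineOfApprox ChainEndFix
open SkeletonPrecomp (precompCoeff precompCoeff_nonneg precompCoeff_le_half)

noncomputable section

variable {d : ℕ} {n : Type*} [Fintype n] [DecidableEq n]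

/-! ## §1 `ApproxRefine` is monotone in the mismatch constant -/

/-- A larger mismatch constant is a weaker requirement: `ApproxRefine … m → ApproxRefine … m'` for `m ≤ m'`. [folklore] -/
theorem approxRefine_mono {𝒞 : ℕ → Set (Site d → Fin d → (Matrix n n ℂ)ˣ)} {L N : ℕ} {b c b₁ c₁ m m' : ℝ}
    (hA : ApproxRefine d 𝒞 L N b c b₁ c₁ m) (hmm' : m ≤ m') : ApproxRefine d 𝒞 L N b c b₁ c₁ m' := by
  intro j U hU hreg
  obtain ⟨W, hWu, hWp, hWs, hWg, hWm⟩ := hA j U hU hreg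
  exact ⟨W, hWu, hWp, hWs, hWg, fun z κ => (hWm z κ).trans (div_le_div_of_nonneg_right hmm' (by positivity))⟩

/-! ## §2 The regime: three inequalities give the ten numeric side conditions -/

/-- Pure-real core of `sideConds_of_regime` (atoms: `dR = d`, `L2 = L²`, `g`, `A₁ = 8mL³/g`, `A₂ = 8m/g`, `A₃ = 2m/g`).
[folklore] -/
theorem side_core {dR L2 g b b₁ A₁ A₂ A₃ ε : ℝ}
    (hdR : 0 ≤ dR) (hL2 : 1 ≤ L2) (hg0 : 0 < g) (hg1 : g ≤ 1)
    (hb : 0 ≤ b) (hb₁ : 0 ≤ b₁) (hA₁ : 0 ≤ A₁) (hA₂₁ : A₂ ≤ A₁) (hA₃ : 4 * A₃ = A₂)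
    (hε : 2 * b ≤ ε) (hε' : 2 * (b₁ + A₁) ≤ ε)
    (hRb : 2 ^ 15 * (dR + 1) ^ 2 * (dR + 4) ^ 2 * L2 * b ≤ 1)
    (hRr : 2 ^ 10 * (dR + 1) * (dR + 4) * L2 * (b₁ + A₁) ≤ g) :
    512 * (dR + 1) * (dR + 4) * L2 * b ≤ 1 ∧
    512 * (dR + 1) * (dR + 4) * L2 * (b₁ + A₁) ≤ 1 ∧
    b + 226 * (8 * (dR + 1) * (dR + 4)) ^ 2 * b ^ 2 ≤ ε ∧
    512 * (dR + 1) * (dR + 4) * L2 * b₁ ≤ 1 ∧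
    4 * (2 * (8 * (dR + 1) * (dR + 4) * L2 * b₁) + A₃) ≤ g ∧
    b₁ + A₂ ≤ 1 / 2 ∧
    b₁ + A₁ ≤ ε := by
  -- the polynomial `D = (dR+1)(dR+4) ≥ 4`, as an opaque real
  obtain ⟨D, hD⟩ : ∃ D : ℝ, D = (dR + 1) * (dR + 4) := ⟨_, rfl⟩
  have hD4 : 4 ≤ D := by rw [hD]; nlinarith [sq_nonneg dR]
  have e1 : 512 * (dR + 1) * (dR + 4) * L2 * b = 512 * (D * L2 * b) := by rw [hD]; ring
  have e2 : 512 * (dR + 1) * (dR + 4) * L2 * (b₁ + A₁) = 512 * (D * L2 * (b₁ + A₁)) := by rw [hD]; ring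
  have e3 : 226 * (8 * (dR + 1) * (dR + 4)) ^ 2 * b ^ 2 = 14464 * ((D ^ 2 * b) * b) := by rw [hD]; ring
  have e4 : 512 * (dR + 1) * (dR + 4) * L2 * b₁ = 512 * (D * L2 * b₁) := by rw [hD]; ring
  have e5 : 4 * (2 * (8 * (dR + 1) * (dR + 4) * L2 * b₁) + A₃) = 64 * (D * L2 * b₁) + A₂ := by
    rw [hD, ← hA₃]; ring
  have eRb : 2 ^ 15 * (dR + 1) ^ 2 * (dR + 4) ^ 2 * L2 * b = 2 ^ 15 * (D ^ 2 * L2 * b) := by rw [hD]; ring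
  have eRr : 2 ^ 10 * (dR + 1) * (dR + 4) * L2 * (b₁ + A₁) = 2 ^ 10 * (D * L2 * (b₁ + A₁)) := by rw [hD]; ring
  rw [e1, e2, e3, e4, e5]
  rw [eRb] at hRb
  rw [eRr] at hRr
  clear e1 e2 e3 e4 e5 eRb eRr hD hA₃
  have p0 : 0 ≤ D * L2 * b := by positivity
  have p2 : 0 ≤ D * L2 * A₁ := by positivity
  have p3 : D * L2 * b ≤ D * (D * L2 * b) := by
    have := mul_le_mul_of_nonneg_right hD4 p0; linarith
  have p4 : D ^ 2 * b * 1 ≤ D ^ 2 * b * L2 := mul_le_mul_of_nonneg_left hL2 (by positivity)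
  have p5 : D ^ 2 * b ≤ 1 / 2 ^ 15 := by linarith
  have p6 : (D ^ 2 * b) * b ≤ (1 / 2 ^ 15) * b := mul_le_mul_of_nonneg_right p5 hb
  have hDL : 4 ≤ D * L2 := by
    have h := mul_le_mul hD4 hL2 (by norm_num) (by positivity); linarith
  have p7 : 4 * (b₁ + A₁) ≤ D * L2 * (b₁ + A₁) := mul_le_mul_of_nonneg_right hDL (add_nonneg hb₁ hA₁)
  have p9 : 4 * A₁ ≤ D * L2 * A₁ := mul_le_mul_of_nonneg_right hDL hA₁
  refine ⟨?_, ?_, ?_, ?_, ?_, ?_, ?_⟩ <;> linarith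

/-- **THE SIX SIDE CONDITIONS OF `actionRate_sfClass_of_exists_approxRefine` FROM THE REGIME** (any `d`, `L ≥ 1`):
(Rb) `2¹⁵(d+1)²(d+4)²L²·b ≤ 1`, (Rr) `2¹⁰(d+1)(d+4)L²·(b₁ + 8mL³/g) ≤ g`, (Rε) `2·max b (b₁ + 8mL³/g) ≤ ε` (`g = gap d L`) imply
`512(d+1)(d+4)L²·max b (b₁ + 8mL³/g) ≤ 1`, `b + 226(8(d+1)(d+4))²b² ≤ ε`, `512(d+1)(d+4)L²b₁ ≤ 1`,
`4(2(8(d+1)(d+4)L²b₁) + 2m/g) ≤ g`, `b₁ + 8m/g ≤ 1/2`, `b₁ + 8mL³/g ≤ ε` — the binders `hBs hbε hbs₁ hgap hhalf hε` verbatim.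
[folklore] -/
theorem sideConds_of_regime {L : ℕ} (hL : 1 ≤ L) {b b₁ m ε : ℝ} (hb : 0 ≤ b) (hb₁ : 0 ≤ b₁) (hm : 0 ≤ m)
    (hRb : 2 ^ 15 * ((d : ℝ) + 1) ^ 2 * ((d : ℝ) + 4) ^ 2 * (L : ℝ) ^ 2 * b ≤ 1)
    (hRr : 2 ^ 10 * ((d : ℝ) + 1) * ((d : ℝ) + 4) * (L : ℝ) ^ 2 * (b₁ + 8 * m * (L : ℝ) ^ 3 / gap d L) ≤ gap d L)
    (hRε : 2 * max b (b₁ + 8 * m * (L : ℝ) ^ 3 / gap d L) ≤ ε) :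
    512 * (d + 1) * (d + 4) * (L : ℝ) ^ 2 * max b (b₁ + 8 * m * (L : ℝ) ^ 3 / gap d L) ≤ 1 ∧
    b + 226 * (8 * (d + 1) * (d + 4)) ^ 2 * b ^ 2 ≤ ε ∧
    512 * (d + 1) * (d + 4) * (L : ℝ) ^ 2 * b₁ ≤ 1 ∧
    4 * (2 * (8 * (d + 1) * (d + 4) * (L : ℝ) ^ 2 * b₁) + 2 * m / gap d L) ≤ gap d L ∧
    b₁ + 8 * m / gap d L ≤ 1 / 2 ∧
    b₁ + 8 * m * (L : ℝ) ^ 3 / gap d L ≤ ε := by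
  obtain ⟨hg0, hg1⟩ := gap_pos (d := d) hL
  have hL1 : (1 : ℝ) ≤ L := by exact_mod_cast hL
  have hL2 : (1 : ℝ) ≤ (L : ℝ) ^ 2 := one_le_pow₀ hL1
  have hL3 : (1 : ℝ) ≤ (L : ℝ) ^ 3 := one_le_pow₀ hL1
  have hdR : (0 : ℝ) ≤ d := Nat.cast_nonneg d
  have hA₁ : 0 ≤ 8 * m * (L : ℝ) ^ 3 / gap d L := by positivity
  have hA₂₁ : 8 * m / gap d L ≤ 8 * m * (L : ℝ) ^ 3 / gap d L :=
    div_le_div_of_nonneg_right (le_mul_of_one_le_right (by positivity) hL3) hg0.le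
  have hA₃ : 4 * (2 * m / gap d L) = 8 * m / gap d L := by ring
  have hbM := le_max_left b (b₁ + 8 * m * (L : ℝ) ^ 3 / gap d L)
  have hrM := le_max_right b (b₁ + 8 * m * (L : ℝ) ^ 3 / gap d L)
  have hεb : 2 * b ≤ ε := by linarith
  have hεr : 2 * (b₁ + 8 * m * (L : ℝ) ^ 3 / gap d L) ≤ ε := by linarith
  obtain ⟨c1, c1', c2, c3, c4, c5, c6⟩ := side_core hdR hL2 hg0 hg1 hb hb₁ hA₁ hA₂₁ hA₃ hεb hεr hRb hRr
  refine ⟨?_, c2, c3, c4, c5, c6⟩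
  rcases le_total b (b₁ + 8 * m * (L : ℝ) ^ 3 / gap d L) with h | h
  · rw [max_eq_right h]; exact c1'
  · rw [max_eq_left h]; exact c1

/-- Pure-real core of `fillConds_of_regime` (atoms: `dR = d`, `L2 = L²`, `g`, `A₁ = 8mL³/g`, `pc = precompCoeff L`;
`hdc` is the integrality of `d`). [folklore] -/
theorem fill_core {dR L2 g b c b₁ A₁ m pc : ℝ}
    (hdR : 0 ≤ dR) (hL2 : 1 ≤ L2) (hg1 : g ≤ 1)
    (hb : 0 ≤ b) (hc : 0 ≤ c) (hb₁ : 0 ≤ b₁) (hm : 0 ≤ m) (hpc0 : 0 ≤ pc) (hpc : pc ≤ 1 / 2)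
    (hmA : 8 * m ≤ A₁) (hcm : 3 * (dR - 1) ^ 2 * c ≤ m) (hdc : (dR - 1) * c ≤ (dR - 1) ^ 2 * c)
    (hRb : 2 ^ 15 * (dR + 1) ^ 2 * (dR + 4) ^ 2 * L2 * b ≤ 1)
    (hRr : 2 ^ 10 * (dR + 1) * (dR + 4) * L2 * (b₁ + A₁) ≤ g) :
    (8 * dR - 7) * b ≤ 1 / 16 ∧ (dR - 1) * b ≤ 1 / 2 ∧
    2 * (pc * ((dR - 1) * c)) + 37 * ((dR - 1) * b) ^ 2 + 4 * b * ((dR - 1) * b) ≤ 1 / 4 ∧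
    512 * (dR + 1) * (dR + 4) * L2 * b₁ ≤ 1 := by
  obtain ⟨D, hD⟩ : ∃ D : ℝ, D = (dR + 1) * (dR + 4) := ⟨_, rfl⟩
  have hD4 : 4 ≤ D := by rw [hD]; nlinarith [sq_nonneg dR]
  have hDd : dR + 1 ≤ D := by rw [hD]; nlinarith [sq_nonneg dR]
  have eRb : 2 ^ 15 * (dR + 1) ^ 2 * (dR + 4) ^ 2 * L2 * b = 2 ^ 15 * (D ^ 2 * L2 * b) := by rw [hD]; ring
  have eRr : 2 ^ 10 * (dR + 1) * (dR + 4) * L2 * (b₁ + A₁) = 2 ^ 10 * (D * L2 * (b₁ + A₁)) := by rw [hD]; ring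
  have e4 : 512 * (dR + 1) * (dR + 4) * L2 * b₁ = 512 * (D * L2 * b₁) := by rw [hD]; ring
  rw [e4]
  rw [eRb] at hRb
  rw [eRr] at hRr
  -- `X = (dR+1)·b` is tiny
  obtain ⟨X, hX⟩ : ∃ X : ℝ, X = (dR + 1) * b := ⟨_, rfl⟩
  have hX0 : 0 ≤ X := by rw [hX]; positivity
  have q1 : X ≤ D * b := by rw [hX]; exact mul_le_mul_of_nonneg_right hDd hb
  have hDL : 4 ≤ D * L2 := by
    have h := mul_le_mul hD4 hL2 (by norm_num) (by positivity); linarith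
  have q2 : D * b * 4 ≤ D * b * (D * L2) := mul_le_mul_of_nonneg_left hDL (by positivity)
  have q3 : D * b * (D * L2) = D ^ 2 * L2 * b := by ring
  have hXs : X ≤ 1 / 2 ^ 17 := by linarith
  -- the `(dR − 1)`-terms against `X`
  have hdRb : 0 ≤ dR * b := mul_nonneg hdR hb
  have r1 : (8 * dR - 7) * b ≤ 8 * X := by rw [hX]; linarith
  have r2 : (dR - 1) * b ≤ X := by rw [hX]; linarith
  have r3 : ((dR - 1) * b) ^ 2 ≤ X ^ 2 := by
    have habs : |(dR - 1) * b| ≤ X := by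
      rw [abs_le]; constructor
      · rw [hX]; linarith
      · exact r2
    calc ((dR - 1) * b) ^ 2 = |(dR - 1) * b| ^ 2 := (sq_abs _).symm
      _ ≤ X ^ 2 := pow_le_pow_left₀ (abs_nonneg _) habs 2
  have r4 : 4 * b * ((dR - 1) * b) ≤ 4 * X ^ 2 := by
    have h1 : b ≤ X := by rw [hX]; linarith
    rcases le_or_gt 0 ((dR - 1) * b) with hpos | hneg
    · have := mul_le_mul h1 r2 hpos hX0; linarith
    · have h3 : b * ((dR - 1) * b) ≤ 0 := mul_nonpos_of_nonneg_of_nonpos hb hneg.le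
      have h4 := sq_nonneg X
      linarith
  have hX2 : X ^ 2 ≤ 1 / 2 ^ 17 * X := by
    have := mul_le_mul_of_nonneg_right hXs hX0; linarith
  -- the `c`-term: `2·pc·(dR−1)c ≤ (dR−1)c ≤ (dR−1)²c ≤ m/3 ≤ A₁/24`, and `A₁` is tiny
  have s1 : 2 * (pc * ((dR - 1) * c)) ≤ (dR - 1) ^ 2 * c := by
    rcases le_or_gt 0 ((dR - 1) * c) with hpos | hneg
    · have := mul_le_mul_of_nonneg_right hpc hpos; linarith
    · have h3 : pc * ((dR - 1) * c) ≤ 0 := mul_nonpos_of_nonneg_of_nonpos hpc0 hneg.le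
      have h4 := mul_nonneg (sq_nonneg (dR - 1)) hc
      linarith
  have hA₁ : 0 ≤ A₁ := by linarith
  have s2 : 4 * A₁ ≤ D * L2 * A₁ := mul_le_mul_of_nonneg_right hDL hA₁
  have s3 : 0 ≤ D * L2 * b₁ := by positivity
  have s5 : 0 ≤ D * L2 * A₁ := by positivity
  have hA₁s : A₁ ≤ 1 / 2 ^ 12 := by linarith
  refine ⟨by linarith, by linarith, ?_, by linarith⟩
  have hX2' : X ^ 2 ≤ 1 / 2 ^ 34 := by linarith
  linarith

/-- **THE FOUR SIDE CONDITIONS OF `approxRefine_of_fillBounds` FROM THE REGIME** (any `d`, `L ≥ 1`; the mismatch constant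
enters only through `3(d−1)²c ≤ m`, true for leaf-09's `m⋆` and any `m ≥ m⋆`): (Rb) and (Rr) imply `(8d−7)b ≤ 1/16`,
`(d−1)b ≤ 1/2`, `2(precompCoeff L·((d−1)c)) + 37((d−1)b)² + 4b((d−1)b) ≤ 1/4`, `512(d+1)(d+4)L²b₁ ≤ 1` — the binders
`h16 hhalf hquarter h512` verbatim. [folklore] -/
theorem fillConds_of_regime {L : ℕ} (hL : 1 ≤ L) {b c b₁ m : ℝ} (hb : 0 ≤ b) (hc : 0 ≤ c) (hb₁ : 0 ≤ b₁)
    (hm : 0 ≤ m) (hcm : 3 * ((d : ℝ) - 1) ^ 2 * c ≤ m)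
    (hRb : 2 ^ 15 * ((d : ℝ) + 1) ^ 2 * ((d : ℝ) + 4) ^ 2 * (L : ℝ) ^ 2 * b ≤ 1)
    (hRr : 2 ^ 10 * ((d : ℝ) + 1) * ((d : ℝ) + 4) * (L : ℝ) ^ 2 * (b₁ + 8 * m * (L : ℝ) ^ 3 / gap d L) ≤ gap d L) :
    (8 * (d : ℝ) - 7) * b ≤ 1 / 16 ∧ ((d : ℝ) - 1) * b ≤ 1 / 2 ∧
    2 * (precompCoeff L * (((d : ℝ) - 1) * c)) + 37 * (((d : ℝ) - 1) * b) ^ 2 + 4 * b * (((d : ℝ) - 1) * b) ≤ 1 / 4 ∧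
    512 * (d + 1) * (d + 4) * (L : ℝ) ^ 2 * b₁ ≤ 1 := by
  obtain ⟨hg0, hg1⟩ := gap_pos (d := d) hL
  have hL1 : (1 : ℝ) ≤ L := by exact_mod_cast hL
  have hL2 : (1 : ℝ) ≤ (L : ℝ) ^ 2 := one_le_pow₀ hL1
  have hL3 : (1 : ℝ) ≤ (L : ℝ) ^ 3 := one_le_pow₀ hL1
  have hdR : (0 : ℝ) ≤ d := Nat.cast_nonneg d
  have hpc0 := precompCoeff_nonneg hL
  have hpc := precompCoeff_le_half hL
  have hmA : 8 * m ≤ 8 * m * (L : ℝ) ^ 3 / gap d L := by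
    rw [le_div_iff₀ hg0]
    have h1 : 8 * m * gap d L ≤ 8 * m * 1 := mul_le_mul_of_nonneg_left hg1 (by positivity)
    have h2 : 8 * m ≤ 8 * m * (L : ℝ) ^ 3 := le_mul_of_one_le_right (by positivity) hL3
    linarith
  have hdc : ((d : ℝ) - 1) * c ≤ ((d : ℝ) - 1) ^ 2 * c := by
    have key : (d : ℝ) - 1 ≤ ((d : ℝ) - 1) ^ 2 := by
      rcases Nat.lt_or_ge d 2 with h | h
      · interval_cases d <;> norm_num
      · have h2 : (2 : ℝ) ≤ d := by exact_mod_cast h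
        nlinarith
    exact mul_le_mul_of_nonneg_right key hc
  exact fill_core hdR hL2 hg1 hb hc hb₁ hm hpc0 hpc hmA hcm hdc hRb hRr

/-! ## §3 One threshold -/

/-- Pure-real core of `regime_of_small` (atoms: `D1 = d+1`, `D4 = d+4`, `Lr = L`, `Ld = L^d`; `dR = d = D1 − 1`).
[folklore] -/
theorem small_core {dR D1 D4 Lr Ld t b c b₁ c₁ : ℝ}
    (hdR : 1 ≤ dR) (hD1 : D1 = dR + 1) (hD4 : D4 = dR + 4) (hLr : 1 ≤ Lr) (hLd : 1 ≤ Ld)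
    (hb : 0 ≤ b) (hb₁ : 0 ≤ b₁) (hbt : b ≤ t) (hct : c ≤ t) (hb₁t : b₁ ≤ t) (hc₁t : c₁ ≤ t)
    (ht : 2 ^ 17 * D1 ^ 3 * D4 ^ 2 * (Ld ^ 2 * Lr ^ 3) * t ≤ 1) :
    3 * (1280 * dR * D1 ^ 2 * D4 ^ 2 * Lr ^ 2 * b₁ ^ 2 + dR * D1 * c₁
        + (dR - 1) ^ 2 * (c + (37 * (dR - 1) + 4) * b ^ 2)) ≤ 9 * D1 ^ 2 * t ∧
    2 ^ 15 * D1 ^ 2 * D4 ^ 2 * Lr ^ 2 * b ≤ 1 ∧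
    2 ^ 10 * D1 * D4 * Lr ^ 2 * (b₁ + 8 * (9 * D1 ^ 2 * t) * (Lr ^ 2 * Ld)) * Ld ≤ Lr ∧
    2 * max b (b₁ + 8 * (9 * D1 ^ 2 * t) * (Lr ^ 2 * Ld)) ≤ 146 * D1 ^ 2 * (Lr ^ 2 * Ld) * t := by
  have ht0 : 0 ≤ t := hb.trans hbt
  have hD1' : 2 ≤ D1 := by rw [hD1]; linarith
  have hD4' : 5 ≤ D4 := by rw [hD4]; linarith
  have hD10 : 0 ≤ D1 := by linarith
  have hD40 : 0 ≤ D4 := by linarith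
  have hD11 : 1 ≤ D1 := by linarith
  have hD41 : 1 ≤ D4 := by linarith
  -- the master monomial `M = D1³ D4² Ld² Lr³ t ≤ 2^{-17}`
  obtain ⟨M, hM⟩ : ∃ M : ℝ, M = D1 ^ 3 * D4 ^ 2 * (Ld ^ 2 * Lr ^ 3) * t := ⟨_, rfl⟩
  have hM0 : 0 ≤ M := by rw [hM]; positivity
  have hMs : M ≤ 1 / 2 ^ 17 := by rw [hM]; linarith
  have hLr2 : 1 ≤ Lr ^ 2 := one_le_pow₀ hLr
  have hLr3 : 1 ≤ Lr ^ 3 := one_le_pow₀ hLr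
  have hLd2 : 1 ≤ Ld ^ 2 := one_le_pow₀ hLd
  have hD12 : 1 ≤ D1 ^ 2 := one_le_pow₀ hD11
  have hLdLr : 1 ≤ Ld ^ 2 * Lr := one_le_mul_of_one_le_of_one_le hLd2 hLr
  have hLrLd : 1 ≤ Lr ^ 2 * Ld := one_le_mul_of_one_le_of_one_le hLr2 hLd
  have hDt2 : 2 * t ≤ D1 * t := mul_le_mul_of_nonneg_right hD1' ht0
  refine ⟨?_, ?_, ?_, ?_⟩
  · -- m⋆ ≤ 9 D1² t
    -- T₁: 1280 dR D1² D4² Lr² b₁² ≤ 1280 · D1³ D4² Lr² · t·b₁ ≤ (1280/2^17)·t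
    have a1 : b₁ ^ 2 ≤ t * b₁ := by rw [sq]; exact mul_le_mul_of_nonneg_right hb₁t hb₁
    have a2 : dR ≤ D1 := by rw [hD1]; linarith
    have a3 : 0 ≤ D1 ^ 2 * D4 ^ 2 * Lr ^ 2 := by positivity
    have a4 : dR * (D1 ^ 2 * D4 ^ 2 * Lr ^ 2 * b₁ ^ 2) ≤ D1 * (D1 ^ 2 * D4 ^ 2 * Lr ^ 2 * (t * b₁)) := by
      have h1 : D1 ^ 2 * D4 ^ 2 * Lr ^ 2 * b₁ ^ 2 ≤ D1 ^ 2 * D4 ^ 2 * Lr ^ 2 * (t * b₁) :=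
        mul_le_mul_of_nonneg_left a1 a3
      exact mul_le_mul a2 h1 (by positivity) hD10
    have a5 : D1 ^ 3 * D4 ^ 2 * Lr ^ 2 * (t * b₁) * 1 ≤ D1 ^ 3 * D4 ^ 2 * Lr ^ 2 * (t * b₁) * (Ld ^ 2 * Lr) :=
      mul_le_mul_of_nonneg_left hLdLr (by positivity)
    have a6 : D1 ^ 3 * D4 ^ 2 * Lr ^ 2 * (t * b₁) * (Ld ^ 2 * Lr) = M * b₁ := by rw [hM]; ring
    have a7 : M * b₁ ≤ 1 / 2 ^ 17 * b₁ := mul_le_mul_of_nonneg_right hMs hb₁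
    have hT1 : 1280 * dR * D1 ^ 2 * D4 ^ 2 * Lr ^ 2 * b₁ ^ 2 ≤ 1280 / 2 ^ 17 * t := by
      linarith [a4, a5, a6, a7, hb₁t]
    have hT2 : dR * D1 * c₁ ≤ D1 ^ 2 * t - D1 * t := by
      have h1 : dR * D1 * c₁ ≤ dR * D1 * t := mul_le_mul_of_nonneg_left hc₁t (by positivity)
      have h2 : dR * D1 * t = D1 ^ 2 * t - D1 * t := by rw [hD1]; ring
      linarith
    -- T₃: (dR−1)²(c + (37(dR−1)+4)b²) ≤ (D1−2)²·2t, using 37·D1·b ≤ 1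
    have h37 : (37 * (dR - 1) + 4) * b ^ 2 ≤ t := by
      have h1 : 37 * (dR - 1) + 4 ≤ 37 * D1 := by rw [hD1]; linarith
      have h2 : (37 * (dR - 1) + 4) * b ^ 2 ≤ 37 * D1 * b ^ 2 := mul_le_mul_of_nonneg_right h1 (sq_nonneg b)
      -- 37 D1 t ≤ M ≤ 2^{-17}
      have h3 : 37 * D1 * t ≤ M := by
        have h4 : 2 * 2 ≤ D1 * D1 := mul_le_mul hD1' hD1' (by norm_num) hD10
        have h5 : 4 * D1 ≤ D1 ^ 2 * D1 := by
          rw [sq]; exact mul_le_mul_of_nonneg_right (by linarith) hD10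
        have h6 : (5 : ℝ) * 5 ≤ D4 * D4 := mul_le_mul hD4' hD4' (by norm_num) hD40
        have h7 : 25 * 1 ≤ D4 ^ 2 * (Ld ^ 2 * Lr ^ 3) := by
          rw [sq]; exact mul_le_mul (by linarith) (one_le_mul_of_one_le_of_one_le hLd2 hLr3) (by norm_num)
            (by positivity)
        have h8 : (4 * D1) * (25 * 1) ≤ (D1 ^ 2 * D1) * (D4 ^ 2 * (Ld ^ 2 * Lr ^ 3)) :=
          mul_le_mul h5 h7 (by norm_num) (by positivity)
        have h9 : 37 * D1 ≤ D1 ^ 3 * D4 ^ 2 * (Ld ^ 2 * Lr ^ 3) := by nlinarith [h8]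
        have h10 := mul_le_mul_of_nonneg_right h9 ht0
        rw [hM]; linarith
      have h4 : 37 * D1 * b ≤ 1 := by
        have := mul_le_mul_of_nonneg_left hbt (by positivity : (0 : ℝ) ≤ 37 * D1)
        linarith
      have h5 : 37 * D1 * b * b ≤ 1 * b := mul_le_mul_of_nonneg_right h4 hb
      have h6 : 37 * D1 * b ^ 2 = 37 * D1 * b * b := by ring
      linarith
    have hT3 : (dR - 1) ^ 2 * (c + (37 * (dR - 1) + 4) * b ^ 2) ≤ (D1 ^ 2 - 4 * D1 + 4) * (2 * t) := by
      have h1 : c + (37 * (dR - 1) + 4) * b ^ 2 ≤ 2 * t := by linarith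
      have h2 : (dR - 1) ^ 2 = D1 ^ 2 - 4 * D1 + 4 := by rw [hD1]; ring
      rw [← h2]
      exact mul_le_mul_of_nonneg_left h1 (sq_nonneg _)
    linarith
  · -- (Rb): 2^15 D1² D4² Lr² b ≤ 2^15 D1² D4² Lr² t ≤ 2^15 M ≤ 2^{-2}
    have h1 : 2 ^ 15 * D1 ^ 2 * D4 ^ 2 * Lr ^ 2 * b ≤ 2 ^ 15 * D1 ^ 2 * D4 ^ 2 * Lr ^ 2 * t :=
      mul_le_mul_of_nonneg_left hbt (by positivity)
    have hx : 1 ≤ D1 * Ld ^ 2 * Lr := one_le_mul_of_one_le_of_one_le (one_le_mul_of_one_le_of_one_le hD11 hLd2) hLr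
    have h2 : D1 ^ 2 * D4 ^ 2 * Lr ^ 2 * t * 1 ≤ D1 ^ 2 * D4 ^ 2 * Lr ^ 2 * t * (D1 * Ld ^ 2 * Lr) :=
      mul_le_mul_of_nonneg_left hx (by positivity)
    have h3 : D1 ^ 2 * D4 ^ 2 * Lr ^ 2 * t * (D1 * Ld ^ 2 * Lr) = M := by rw [hM]; ring
    linarith
  · -- (Rr)·Ld: 2^10 D1 D4 Lr² Ld b₁ + 73728 D1³ D4 Lr⁴ Ld² t ≤ Lr
    have h1 : 2 ^ 10 * D1 * D4 * Lr ^ 2 * (b₁ + 8 * (9 * D1 ^ 2 * t) * (Lr ^ 2 * Ld)) * Ld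
        = 2 ^ 10 * (D1 * D4 * Lr ^ 2 * Ld * b₁) + 73728 * (D1 ^ 3 * D4 * Lr ^ 4 * Ld ^ 2 * t) := by ring
    rw [h1]
    -- first: D1 D4 Lr² Ld b₁ ≤ D1 D4 Lr² Ld t ≤ M (D1² D4 Lr Ld ≥ 1)
    have h2 : D1 * D4 * Lr ^ 2 * Ld * b₁ ≤ D1 * D4 * Lr ^ 2 * Ld * t := mul_le_mul_of_nonneg_left hb₁t (by positivity)
    have hx : 1 ≤ D1 ^ 2 * D4 * Lr * Ld :=
      one_le_mul_of_one_le_of_one_le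
        (one_le_mul_of_one_le_of_one_le (one_le_mul_of_one_le_of_one_le hD12 hD41) hLr) hLd
    have h3 : D1 * D4 * Lr ^ 2 * Ld * t * 1 ≤ D1 * D4 * Lr ^ 2 * Ld * t * (D1 ^ 2 * D4 * Lr * Ld) :=
      mul_le_mul_of_nonneg_left hx (by positivity)
    have h4 : D1 * D4 * Lr ^ 2 * Ld * t * (D1 ^ 2 * D4 * Lr * Ld) = M := by rw [hM]; ring
    -- second: 4·(D1³ D4 Lr⁴ Ld² t) ≤ D4·(…) = Lr·M ≤ Lr/2^17
    have h5 : 4 * (D1 ^ 3 * D4 * Lr ^ 4 * Ld ^ 2 * t) ≤ D4 * (D1 ^ 3 * D4 * Lr ^ 4 * Ld ^ 2 * t) :=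
      mul_le_mul_of_nonneg_right (by linarith) (by positivity)
    have h6 : D4 * (D1 ^ 3 * D4 * Lr ^ 4 * Ld ^ 2 * t) = Lr * M := by rw [hM]; ring
    have h7 : Lr * M ≤ Lr * (1 / 2 ^ 17) := mul_le_mul_of_nonneg_left hMs (by linarith)
    linarith
  · -- 2·max ≤ 146 D1² Lr² Ld t
    have hP : 1 ≤ D1 ^ 2 * (Lr ^ 2 * Ld) := one_le_mul_of_one_le_of_one_le hD12 hLrLd
    have htP : t ≤ D1 ^ 2 * (Lr ^ 2 * Ld) * t := le_mul_of_one_le_left ht0 hP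
    have h1 : b ≤ 73 * D1 ^ 2 * (Lr ^ 2 * Ld) * t := by linarith
    have h2 : b₁ + 8 * (9 * D1 ^ 2 * t) * (Lr ^ 2 * Ld) ≤ 73 * D1 ^ 2 * (Lr ^ 2 * Ld) * t := by linarith
    have := max_le h1 h2
    linarith

/-- **ONE THRESHOLD.**  For `d ≥ 1`, `L ≥ 1`: if `0 ≤ b, b₁ ≤ t`, `c, c₁ ≤ t` and `2¹⁷(d+1)³(d+4)²L^{2d+3}·t ≤ 1`, then leaf-09's
`m⋆ ≤ 9(d+1)²t`, (Rb) holds, (Rr) holds with `m := 9(d+1)²t`, and `2·max b (b₁ + 8mL³/g) ≤ 146(d+1)²L^{d+2}·t` — so (Rε)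
holds as soon as `146(d+1)²L^{d+2}·t ≤ ε`. [folklore] -/
theorem regime_of_small (hd : 1 ≤ d) {L : ℕ} (hL : 1 ≤ L) {t b c b₁ c₁ : ℝ} (hb : 0 ≤ b) (hb₁ : 0 ≤ b₁)
    (hbt : b ≤ t) (hct : c ≤ t) (hb₁t : b₁ ≤ t) (hc₁t : c₁ ≤ t)
    (ht : 2 ^ 17 * ((d : ℝ) + 1) ^ 3 * ((d : ℝ) + 4) ^ 2 * (L : ℝ) ^ (2 * d + 3) * t ≤ 1) :
    3 * (1280 * d * ((d : ℝ) + 1) ^ 2 * ((d : ℝ) + 4) ^ 2 * (L : ℝ) ^ 2 * b₁ ^ 2 + d * ((d : ℝ) + 1) * c₁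
        + ((d : ℝ) - 1) ^ 2 * (c + (37 * ((d : ℝ) - 1) + 4) * b ^ 2)) ≤ 9 * ((d : ℝ) + 1) ^ 2 * t ∧
    2 ^ 15 * ((d : ℝ) + 1) ^ 2 * ((d : ℝ) + 4) ^ 2 * (L : ℝ) ^ 2 * b ≤ 1 ∧
    2 ^ 10 * ((d : ℝ) + 1) * ((d : ℝ) + 4) * (L : ℝ) ^ 2
        * (b₁ + 8 * (9 * ((d : ℝ) + 1) ^ 2 * t) * (L : ℝ) ^ 3 / gap d L) ≤ gap d L ∧
    2 * max b (b₁ + 8 * (9 * ((d : ℝ) + 1) ^ 2 * t) * (L : ℝ) ^ 3 / gap d L)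
        ≤ 146 * ((d : ℝ) + 1) ^ 2 * (L : ℝ) ^ (d + 2) * t := by
  have hL1 : (1 : ℝ) ≤ L := by exact_mod_cast hL
  have hL0 : (0 : ℝ) < L := by linarith
  have hdR : (1 : ℝ) ≤ d := by exact_mod_cast hd
  have hLd : (1 : ℝ) ≤ (L : ℝ) ^ d := one_le_pow₀ hL1
  have hLd0 : (0 : ℝ) < (L : ℝ) ^ d := by positivity
  have hg : gap d L = (L : ℝ) / (L : ℝ) ^ d := gap_eq hL hd
  -- `L³/g = L²·L^d`, `L^{d+2} = L²·L^d`, `L^{2d+3} = (L^d)²·L³`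
  have e1 : (L : ℝ) ^ 3 / gap d L = (L : ℝ) ^ 2 * (L : ℝ) ^ d := by
    rw [hg, div_div_eq_mul_div, show (L : ℝ) ^ 3 * (L : ℝ) ^ d = (L : ℝ) ^ 2 * (L : ℝ) ^ d * L by ring,
      mul_div_cancel_right₀ _ hL0.ne']
  have e2 : (L : ℝ) ^ (d + 2) = (L : ℝ) ^ 2 * (L : ℝ) ^ d := by rw [pow_add]; ring
  have e3 : (L : ℝ) ^ (2 * d + 3) = ((L : ℝ) ^ d) ^ 2 * (L : ℝ) ^ 3 := by rw [pow_add, pow_mul']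
  rw [mul_div_assoc, e1, e2]
  rw [e3] at ht
  obtain ⟨c1, c2, c3, c4⟩ := small_core (D1 := (d : ℝ) + 1) (D4 := (d : ℝ) + 4) hdR rfl rfl hL1 hLd hb hb₁
    hbt hct hb₁t hc₁t ht
  refine ⟨c1, c2, ?_, c4⟩
  rw [hg, le_div_iff₀ hLd0]
  exact c3

end

end Summit.QuantumFields.BalabanUV.T4Continuum.MinimalActionRegime
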